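import Literature.Topology.FourManifolds.TrisectionsJointChart
import Literature.Topology.FourManifolds.SeamBicollar
import Literature.Topology.FourManifolds.SPC4HandleChainProofs
import Literature.Topology.FourManifolds.Morse
import Mathlib.Analysis.Calculus.LineDeriv.Basic
import HarnessLib

/-!
# Hadamard division along a face and on the quadrant; a boundary-adapted function in a chart

Topic `Literature/Topology/FourManifolds`; infrastructure for the fact seat
`provefact-Literature.Topology.FourManifolds.exists-14560f9fc8` (named fact (c′)
`Literature.Topology.FourManifolds.exists_stabilized_gkTrisection`), continuing
`TrisectionsMorseTransport.lean`.  Everything in this file is **proved**; no definitions,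
no named facts.

To compare, near the central surface `F`, the Morse function `f` of the sector manifold `W`
of a Gay–Kirby trisection (read through the embedding `e`) with the product `u · v` of the
global normal coordinates of `TrisectionsNormalCoordinates.lean`, one needs `1 - f ∘ e⁻¹ =
2uv · K` with `K` smooth and positive up to the corner.  This file supplies the calculus:

* `eq_mul_integral_of_face`, `contDiff_face_integral`, `face_integral_of_apply_eq_zero` —
  **Hadamard division along a face**: a `C¹` function on `ℝ⁴` vanishing on (part of) the
  hyperplane `{xₐ = 0}` inside a ball is `xₐ` times the smooth quotient
  `∫₀¹ ∂ₐw(x with a-th coordinate scaled by s) ds`;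
* `exists_quadrant_hadamard` — **on the quadrant**: vanishing on the two closed faces
  `{x₀ = 0 ≤ x₁}`, `{x₁ = 0 ≤ x₀}` gives `P = x₀ x₁ P₂` with `P₂ ∈ C^∞`, `P₂(p) = ∂₁∂₀P(p)`;
* `permanent_pos_of_quadrant` — a quadrant- and stratum-preserving map with injective
  derivative at a stratum point has normal block with nonnegative entries (cone lemma of
  `TrisectionsCentralSurfaceTangent.lean`) and **positive permanent**
  `(Le₀)₀(Le₁)₁ + (Le₁)₀(Le₀)₁`;
* `contDiff_bump_mul'` — cutting off by a bump function with any centre;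
* `exists_hadamard_of_isMorseAdapted` — **a Morse function adapted to the boundary, read in a
  half-space chart of the maximal atlas centred at a boundary point, is `1 - x₀ · c(x)` with
  `c ∈ C^∞(ℝ⁴)`, `c > 0` near `0`** (Seeley's extension across the boundary hyperplane, on which
  the function is `1` by invariance of the boundary for charts of the maximal atlas; Hadamard;
  `c(0) ≥ 0` as `f ≤ 1`, `c(0) ≠ 0` as boundary points are regular).

## References

* J. Milnor, *Morse theory*, Ann. of Math. Studies 51 (1963), §2, Lemma 2.1 (Hadamard's
  lemma) and §3. [Milnor1963]
* R. T. Seeley, *Extension of `C^∞` functions defined in a half space*, Proc. Amer. Math.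
  Soc. 15 (1964), 625–626. [Seeley1964]
* J. Milnor, *Lectures on the h-cobordism theorem* (1965), Def. 3.1 (Morse functions on
  manifolds with boundary). [MilnorHCobordism1965]
-/

open Set Function Filter MeasureTheory intervalIntegral
open scoped Topology ContDiff Manifold

noncomputable section

namespace Literature.Topology.FourManifolds

section FaceHadamard

/-- Scaling one coordinate: `faceScale a x s` has `a`-th coordinate `s xₐ` and the other
coordinates of `x`; written `x + (s xₐ - xₐ) • eₐ`. [folklore] -/
theorem faceScale_apply (a : Fin 4) (x : EuclideanSpace ℝ (Fin 4)) (s : ℝ) (k : Fin 4) :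
    (x + (s * x a - x a) • EuclideanSpace.single a (1:ℝ)) k = if k = a then s * x a else x k := by
  by_cases hk : k = a
  · subst hk; simp
  · simp [hk]

/-- The one-coordinate scaling is jointly smooth in `(x, s)`. [folklore] -/
theorem contDiff_faceScale (a : Fin 4) {n : WithTop ℕ∞} :
    ContDiff ℝ n fun p : EuclideanSpace ℝ (Fin 4) × ℝ =>
      p.1 + (p.2 * p.1 a - p.1 a) • EuclideanSpace.single a (1:ℝ) := by
  have ha : ContDiff ℝ n fun p : EuclideanSpace ℝ (Fin 4) × ℝ => p.1 a :=
    (contDiff_piLp_apply (p := 2) (n := n) (i := a)).comp contDiff_fst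
  exact contDiff_fst.add (((contDiff_snd.mul ha).sub ha).smul contDiff_const)

/-- Derivative of the scaling in `s`: `xₐ • eₐ`. [folklore] -/
theorem hasDerivAt_faceScale (a : Fin 4) (x : EuclideanSpace ℝ (Fin 4)) (s : ℝ) :
    HasDerivAt (fun s : ℝ => x + (s * x a - x a) • EuclideanSpace.single a (1:ℝ))
      ((x a) • EuclideanSpace.single a (1:ℝ)) s := by
  have h1 : HasDerivAt (fun s : ℝ => s * x a - x a) (x a) s := by
    simpa using ((hasDerivAt_id s).mul_const (x a)).sub_const (x a)
  simpa using (h1.smul_const (EuclideanSpace.single a (1:ℝ))).const_add x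

/-- The integrand of the face quotient, `(x, s) ↦ ∂ₐw(scaled x)`, is `Cⁿ` for `w ∈ Cⁿ⁺¹`.
[folklore] -/
theorem contDiff_face_integrand (a : Fin 4) {w : EuclideanSpace ℝ (Fin 4) → ℝ} {n : ℕ∞}
    (hw : ContDiff ℝ (n + 1) w) :
    ContDiff ℝ n (uncurry fun (x : EuclideanSpace ℝ (Fin 4)) (s : ℝ) =>
      fderiv ℝ w (x + (s * x a - x a) • EuclideanSpace.single a (1:ℝ))
        (EuclideanSpace.single a 1)) := by
  have h1 : ContDiff ℝ n fun y => fderiv ℝ w y (EuclideanSpace.single a 1) :=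
    (hw.fderiv_right (m := n) le_rfl).clm_apply contDiff_const
  exact h1.comp (contDiff_faceScale a)

/-- Changing one coordinate of `q` to a value of smaller absolute value does not increase the
Euclidean norm. [folklore] -/
theorem norm_add_sub_smul_single_le' (a : Fin 4) (q : EuclideanSpace ℝ (Fin 4)) {t : ℝ}
    (ht : |t| ≤ |q a|) : ‖q + (t - q a) • EuclideanSpace.single a (1:ℝ)‖ ≤ ‖q‖ := by
  rw [EuclideanSpace.norm_eq, EuclideanSpace.norm_eq]
  refine Real.sqrt_le_sqrt (Finset.sum_le_sum fun k _ => ?_)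
  simp only [Real.norm_eq_abs, sq_abs]
  by_cases hk : k = a
  · subst hk
    have : (q + (t - q k) • EuclideanSpace.single k (1:ℝ)) k = t := by simp
    rw [this, ← sq_abs t, ← sq_abs (q k)]
    exact pow_le_pow_left₀ (abs_nonneg t) ht 2
  · have : (q + (t - q a) • EuclideanSpace.single a (1:ℝ)) k = q k := by simp [hk]
    rw [this]

/-- **Hadamard division along a face.**  If `w ∈ C¹` vanishes on the part `{xₐ = 0} ∩ side`
of a hyperplane inside the ball `B(p, r)` (`pₐ = 0`; `side` a condition preserved by scaling the
`a`-th coordinate, e.g. `0 ≤ x_b` or `True`), then on `B(p, r) ∩ side`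
`w x = xₐ · ∫₀¹ ∂ₐw(x with a-th coordinate s xₐ) ds` (fundamental theorem of calculus along the
segment to the hyperplane, which stays in the ball). [folklore] -/
theorem eq_mul_integral_of_face (a : Fin 4) {side : EuclideanSpace ℝ (Fin 4) → Prop}
    (hside : ∀ (x : EuclideanSpace ℝ (Fin 4)) (s : ℝ), side x →
      side (x + (s * x a - x a) • EuclideanSpace.single a (1:ℝ)))
    {w : EuclideanSpace ℝ (Fin 4) → ℝ} (hw : ContDiff ℝ 1 w) {p : EuclideanSpace ℝ (Fin 4)}
    {r : ℝ} (hpa : p a = 0)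
    (h0 : ∀ x ∈ Metric.ball p r, x a = 0 → side x → w x = 0)
    {x : EuclideanSpace ℝ (Fin 4)} (hx : x ∈ Metric.ball p r) (hxb : side x) :
    w x = x a * ∫ s in (0:ℝ)..1, fderiv ℝ w (x + (s * x a - x a) • EuclideanSpace.single a (1:ℝ))
      (EuclideanSpace.single a 1) := by
  set γ : ℝ → EuclideanSpace ℝ (Fin 4) := fun s =>
    x + (s * x a - x a) • EuclideanSpace.single a (1:ℝ) with hγ
  have hd : ∀ s, HasDerivAt (fun s => w (γ s))
      (x a * fderiv ℝ w (γ s) (EuclideanSpace.single a 1)) s := by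
    intro s
    have h := ((hw.differentiable one_ne_zero) (γ s)).hasFDerivAt.comp_hasDerivAt s
      (hasDerivAt_faceScale a x s)
    simp only [map_smul, smul_eq_mul] at h
    exact h
  have hcont : Continuous fun s => x a * fderiv ℝ w (γ s) (EuclideanSpace.single a 1) :=
    continuous_const.mul
      ((contDiff_face_integrand a (n := 0) (by exact_mod_cast hw)).continuous.comp
        (continuous_const.prodMk continuous_id))
  have hftc := integral_eq_sub_of_hasDerivAt (fun s _ => hd s) (hcont.intervalIntegrable 0 1)
  have hγ1 : γ 1 = x := by simp [hγ]
  -- the foot of the segment lies on the face, inside the ball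
  have hγ0a : γ 0 a = 0 := by simp [hγ]
  have hγ0b : side (γ 0) := hside x 0 hxb
  have hγ0mem : γ 0 ∈ Metric.ball p r := by
    rw [Metric.mem_ball, dist_eq_norm] at hx ⊢
    have heq : γ 0 - p = (x - p) + ((0:ℝ) - (x - p) a) • EuclideanSpace.single a (1:ℝ) := by
      simp only [hγ, zero_mul, zero_sub, PiLp.sub_apply, hpa, sub_zero]
      abel
    rw [heq]
    exact (norm_add_sub_smul_single_le' a (x - p) (by simp)).trans_lt hx
  have hw0 : w (γ 0) = 0 := h0 _ hγ0mem hγ0a hγ0b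
  rw [hγ1, hw0, sub_zero] at hftc
  rw [← hftc, intervalIntegral.integral_const_mul]

/-- **Smoothness of the face quotient**: `w ∈ Cⁿ⁺¹ ⇒ x ↦ ∫₀¹ ∂ₐw(scaled x) ds ∈ Cⁿ`
(`Literature.Analysis.Calculus.contDiff_intervalIntegral`). [folklore] -/
theorem contDiff_face_integral (a : Fin 4) {w : EuclideanSpace ℝ (Fin 4) → ℝ} {n : ℕ∞}
    (hw : ContDiff ℝ (n + 1) w) :
    ContDiff ℝ n fun x : EuclideanSpace ℝ (Fin 4) => ∫ s in (0:ℝ)..1,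
      fderiv ℝ w (x + (s * x a - x a) • EuclideanSpace.single a (1:ℝ))
        (EuclideanSpace.single a 1) :=
  Literature.Analysis.Calculus.contDiff_intervalIntegral (contDiff_face_integrand a hw) 0 1

/-- **Value of the face quotient on the hyperplane `{xₐ = 0}`**: the scaling is then constant,
so the quotient is `∂ₐw(x)`. [folklore] -/
theorem face_integral_of_apply_eq_zero (a : Fin 4) {w : EuclideanSpace ℝ (Fin 4) → ℝ}
    {x : EuclideanSpace ℝ (Fin 4)} (hxa : x a = 0) :
    (∫ s in (0:ℝ)..1, fderiv ℝ w (x + (s * x a - x a) • EuclideanSpace.single a (1:ℝ))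
        (EuclideanSpace.single a 1)) = fderiv ℝ w x (EuclideanSpace.single a 1) := by
  have : (fun s : ℝ => fderiv ℝ w (x + (s * x a - x a) • EuclideanSpace.single a (1:ℝ))
      (EuclideanSpace.single a 1)) = fun _ => fderiv ℝ w x (EuclideanSpace.single a 1) := by
    funext s; simp [hxa]
  rw [this, intervalIntegral.integral_const, sub_zero, one_smul]


/-- **Hadamard division on the quadrant.**  If `P ∈ C^∞` vanishes, inside the ball `B(p, r)`
(`p₀ = p₁ = 0`), on the two closed faces `{x₀ = 0 ≤ x₁}` and `{x₁ = 0 ≤ x₀}` of the quadrant,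
then `P = x₀ x₁ P₂` on `B(p, r) ∩ {x₀, x₁ ≥ 0}` for a `C^∞` function `P₂` with
`P₂(p) = ∂₁∂₀P(p)` (Hadamard division along the first face, whose quotient vanishes on the
second face — at its points with `x₀ > 0` by the identity, at the stratum points by continuity —
and Hadamard division of the quotient along the second face). [folklore] -/
theorem exists_quadrant_hadamard {P : EuclideanSpace ℝ (Fin 4) → ℝ} (hP : ContDiff ℝ ∞ P)
    {p : EuclideanSpace ℝ (Fin 4)} {r : ℝ} (hp0 : p 0 = 0) (hp1 : p 1 = 0)
    (h0 : ∀ x ∈ Metric.ball p r, x 0 = 0 → 0 ≤ x 1 → P x = 0)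
    (h1 : ∀ x ∈ Metric.ball p r, x 1 = 0 → 0 ≤ x 0 → P x = 0) :
    ∃ P₂ : EuclideanSpace ℝ (Fin 4) → ℝ, ContDiff ℝ ∞ P₂ ∧
      (∀ x ∈ Metric.ball p r, 0 ≤ x 0 → 0 ≤ x 1 → P x = x 0 * x 1 * P₂ x) ∧
      P₂ p = fderiv ℝ (fun x => fderiv ℝ P x (EuclideanSpace.single 0 1)) p
        (EuclideanSpace.single 1 1) := by
  have hP' : ContDiff ℝ ((⊤ : ℕ∞) + 1) P := by exact_mod_cast hP
  -- first division, along the face `{x₀ = 0}`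
  set P₁ : EuclideanSpace ℝ (Fin 4) → ℝ := fun x => ∫ s in (0:ℝ)..1,
    fderiv ℝ P (x + (s * x 0 - x 0) • EuclideanSpace.single 0 (1:ℝ)) (EuclideanSpace.single 0 1)
    with hP₁
  have hP₁s : ContDiff ℝ ∞ P₁ := by
    have := contDiff_face_integral (0 : Fin 4) (n := ⊤) hP'
    exact_mod_cast this
  have hP₁eq : ∀ x ∈ Metric.ball p r, 0 ≤ x 1 → P x = x 0 * P₁ x := fun x hx hx1 =>
    eq_mul_integral_of_face 0 (side := fun x => 0 ≤ x 1) (fun x s h => by simpa using h)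
      (hP.of_le (by norm_cast)) hp0 h0 hx hx1
  -- the quotient vanishes on the second face
  have hP₁zero : ∀ x ∈ Metric.ball p r, x 1 = 0 → 0 ≤ x 0 → P₁ x = 0 := by
    intro x hx hx1 hx0
    rcases hx0.lt_or_eq with hpos | hzero
    · have h := hP₁eq x hx (le_of_eq hx1.symm)
      rw [h1 x hx hx1 hx0] at h
      rcases mul_eq_zero.mp h.symm with h' | h'
      · exact absurd h' hpos.ne'
      · exact h'
    · -- at a stratum point: limit of the values at `x + t e₀`, `t → 0⁺`
      have hcont : ContinuousAt P₁ x := hP₁s.continuous.continuousAt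
      have hlim : Tendsto (fun t : ℝ => P₁ (x + t • EuclideanSpace.single 0 (1:ℝ)))
          (𝓝[>] 0) (𝓝 (P₁ x)) := by
        have hc : Tendsto (fun t : ℝ => x + t • EuclideanSpace.single 0 (1:ℝ)) (𝓝 0) (𝓝 x) := by
          have : Continuous fun t : ℝ => x + t • EuclideanSpace.single 0 (1:ℝ) := by fun_prop
          simpa using this.tendsto 0
        exact (hcont.tendsto.comp hc).mono_left nhdsWithin_le_nhds
      have hev : ∀ᶠ t in 𝓝[>] (0:ℝ), P₁ (x + t • EuclideanSpace.single 0 (1:ℝ)) = 0 := by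
        have hball : ∀ᶠ t in 𝓝 (0:ℝ), x + t • EuclideanSpace.single 0 (1:ℝ) ∈ Metric.ball p r := by
          have hc : Continuous fun t : ℝ => x + t • EuclideanSpace.single 0 (1:ℝ) := by fun_prop
          have := hc.tendsto 0
          simp only [zero_smul, add_zero] at this
          exact this (Metric.isOpen_ball.mem_nhds hx)
        filter_upwards [hball.filter_mono nhdsWithin_le_nhds, self_mem_nhdsWithin] with t ht htpos
        have htpos' : 0 < t := htpos
        have hy1 : (x + t • EuclideanSpace.single 0 (1:ℝ) : EuclideanSpace ℝ (Fin 4)) 1 = 0 := by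
          simp [hx1]
        have hy0 : 0 < (x + t • EuclideanSpace.single 0 (1:ℝ) : EuclideanSpace ℝ (Fin 4)) 0 := by
          simp [← hzero, htpos']
        have h := hP₁eq _ ht (le_of_eq hy1.symm)
        rw [h1 _ ht hy1 hy0.le] at h
        rcases mul_eq_zero.mp h.symm with h' | h'
        · exact absurd h' hy0.ne'
        · exact h'
      have hlim0 : Tendsto (fun t : ℝ => P₁ (x + t • EuclideanSpace.single 0 (1:ℝ)))
          (𝓝[>] 0) (𝓝 0) :=
        (tendsto_const_nhds (x := (0:ℝ))).congr' (hev.mono fun t ht => ht.symm)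
      exact tendsto_nhds_unique hlim hlim0
  -- second division, along the face `{x₁ = 0}`
  have hP₁' : ContDiff ℝ ((⊤ : ℕ∞) + 1) P₁ := by exact_mod_cast hP₁s
  set P₂ : EuclideanSpace ℝ (Fin 4) → ℝ := fun x => ∫ s in (0:ℝ)..1,
    fderiv ℝ P₁ (x + (s * x 1 - x 1) • EuclideanSpace.single 1 (1:ℝ)) (EuclideanSpace.single 1 1)
    with hP₂
  have hP₂s : ContDiff ℝ ∞ P₂ := by
    have := contDiff_face_integral (1 : Fin 4) (n := ⊤) hP₁'
    exact_mod_cast this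
  have hP₂eq : ∀ x ∈ Metric.ball p r, 0 ≤ x 0 → P₁ x = x 1 * P₂ x := fun x hx hx0 =>
    eq_mul_integral_of_face 1 (side := fun x => 0 ≤ x 0) (fun x s h => by simpa using h)
      (hP₁s.of_le (by norm_cast)) hp1 hP₁zero hx hx0
  refine ⟨P₂, hP₂s, fun x hx hx0 hx1 => ?_, ?_⟩
  · rw [hP₁eq x hx hx1, hP₂eq x hx hx0]; ring
  · -- the value at `p`: `P₂ p = ∂₁P₁(p)` and `P₁ = ∂₀P` on `{x₀ = 0}`
    rw [hP₂]
    dsimp only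
    rw [face_integral_of_apply_eq_zero 1 hp1]
    -- derivatives along the line `p + t e₁ ⊂ {x₀ = 0}` agree
    set g : EuclideanSpace ℝ (Fin 4) → ℝ := fun x => fderiv ℝ P x (EuclideanSpace.single 0 1)
      with hg
    have hline : ∀ t : ℝ, P₁ (p + t • EuclideanSpace.single 1 (1:ℝ)) =
        g (p + t • EuclideanSpace.single 1 (1:ℝ)) := by
      intro t
      have h0' : (p + t • EuclideanSpace.single 1 (1:ℝ) : EuclideanSpace ℝ (Fin 4)) 0 = 0 := by
        simp [hp0]
      simp only [hP₁, hg]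
      exact face_integral_of_apply_eq_zero 0 h0'
    have hgd : DifferentiableAt ℝ g p := by
      have : ContDiff ℝ ∞ g := (hP.fderiv_right (m := ∞) le_rfl).clm_apply contDiff_const
      exact this.differentiable (by simp) p
    have h1' : HasLineDerivAt ℝ P₁ (fderiv ℝ P₁ p (EuclideanSpace.single 1 1)) p
        (EuclideanSpace.single 1 (1:ℝ)) :=
      (hP₁s.differentiable (by simp) p).hasFDerivAt.hasLineDerivAt _
    have h2' : HasLineDerivAt ℝ g (fderiv ℝ g p (EuclideanSpace.single 1 1)) p
        (EuclideanSpace.single 1 (1:ℝ)) :=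
      hgd.hasFDerivAt.hasLineDerivAt _
    unfold HasLineDerivAt at h1' h2'
    have hfun : (fun t : ℝ => P₁ (p + t • EuclideanSpace.single 1 (1:ℝ))) =
        fun t => g (p + t • EuclideanSpace.single 1 (1:ℝ)) := funext hline
    rw [hfun] at h1'
    exact h1'.unique h2'

end FaceHadamard


section Permanent

variable {σ : EuclideanSpace ℝ (Fin 4) → EuclideanSpace ℝ (Fin 4)}
  {L : EuclideanSpace ℝ (Fin 4) →L[ℝ] EuclideanSpace ℝ (Fin 4)} {p : EuclideanSpace ℝ (Fin 4)}

/-- Along the line `t ↦ p + t v` the points stay in the domain of an `eventually` hypothesis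
(copy of the private helper of `TrisectionsCentralSurfaceTangent.lean`). [folklore] -/
private theorem eventually_line' {P : EuclideanSpace ℝ (Fin 4) → Prop} (hP : ∀ᶠ z in 𝓝 p, P z)
    (v : EuclideanSpace ℝ (Fin 4)) : ∀ᶠ t in 𝓝[>] (0:ℝ), P (p + t • v) := by
  have hc : Tendsto (fun t : ℝ => p + t • v) (𝓝 0) (𝓝 p) := by
    have : Continuous fun t : ℝ => p + t • v := by fun_prop
    simpa using this.tendsto 0
  exact (hc.eventually hP).filter_mono nhdsWithin_le_nhds

/-- **A quadrant-preserving local diffeomorphism has positive "permanent" at the corner.**  If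
`σ`, differentiable at the stratum point `p` with injective derivative `L`, maps the closed
quadrant `{z₀ ≥ 0, z₁ ≥ 0}` into itself and stratum points to stratum points near `p`, then the
normal block `N = ((Le₀)₀ (Le₁)₀; (Le₀)₁ (Le₁)₁)` of `L` has nonnegative entries (cone lemma)
and nonzero determinant (injectivity and stratum invariance), hence positive permanent
`(Le₀)₀(Le₁)₁ + (Le₁)₀(Le₀)₁ > 0` — the mixed second derivative `∂₀∂₁(σ₀σ₁)(p)`. [folklore] -/
theorem permanent_pos_of_quadrant (hσ : HasFDerivAt σ L p) (hLinj : Injective L)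
    (hp : p 0 = 0 ∧ p 1 = 0)
    (hQ : ∀ᶠ z in 𝓝 p, (0 ≤ z 0 ∧ 0 ≤ z 1) → (0 ≤ σ z 0 ∧ 0 ≤ σ z 1))
    (hstr : ∀ᶠ z in 𝓝 p, (z 0 = 0 ∧ z 1 = 0) → (σ z 0 = 0 ∧ σ z 1 = 0)) :
    (0 ≤ L (EuclideanSpace.single 0 1) 0 ∧ 0 ≤ L (EuclideanSpace.single 0 1) 1 ∧
      0 ≤ L (EuclideanSpace.single 1 1) 0 ∧ 0 ≤ L (EuclideanSpace.single 1 1) 1) ∧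
    0 < L (EuclideanSpace.single 0 1) 0 * L (EuclideanSpace.single 1 1) 1 +
      L (EuclideanSpace.single 1 1) 0 * L (EuclideanSpace.single 0 1) 1 := by
  have hσp : σ p 0 = 0 ∧ σ p 1 = 0 := hstr.self_of_nhds hp
  have hLstr : ∀ w : EuclideanSpace ℝ (Fin 4), w 0 = 0 → w 1 = 0 → L w 0 = 0 ∧ L w 1 = 0 :=
    fun w hw0 hw1 => apply_stratum_of_hasFDerivAt hσ hp hstr hw0 hw1
  set e0 : EuclideanSpace ℝ (Fin 4) := EuclideanSpace.single 0 1 with he0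
  set e1 : EuclideanSpace ℝ (Fin 4) := EuclideanSpace.single 1 1 with he1
  -- cone lemma: `L eₖ` lies in the closed quadrant for `k = 0, 1`
  have hKc : IsClosed {q : EuclideanSpace ℝ (Fin 4) | 0 ≤ q 0 ∧ 0 ≤ q 1} :=
    (isClosed_le continuous_const (EuclideanSpace.proj (0 : Fin 4)).continuous).inter
      (isClosed_le continuous_const (EuclideanSpace.proj (1 : Fin 4)).continuous)
  have hcone : ∀ v : EuclideanSpace ℝ (Fin 4), 0 ≤ v 0 → 0 ≤ v 1 → 0 ≤ L v 0 ∧ 0 ≤ L v 1 := by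
    intro v hv0 hv1
    refine mem_of_tendsto_smul_of_cone (K := {q | 0 ≤ q 0 ∧ 0 ≤ q 1}) hKc ?_ ?_
      (tendsto_smul_sub_of_hasFDerivAt hσ v)
    · rintro t ht k ⟨hk0, hk1⟩
      exact ⟨by simpa using mul_nonneg ht.le hk0, by simpa using mul_nonneg ht.le hk1⟩
    · filter_upwards [eventually_line' hQ v, self_mem_nhdsWithin] with t hq htpos
      have ht : 0 < t := htpos
      have hz0 : 0 ≤ (p + t • v) 0 := by
        simp only [PiLp.add_apply, PiLp.smul_apply, smul_eq_mul, hp.1, zero_add]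
        exact mul_nonneg ht.le hv0
      have hz1 : 0 ≤ (p + t • v) 1 := by
        simp only [PiLp.add_apply, PiLp.smul_apply, smul_eq_mul, hp.2, zero_add]
        exact mul_nonneg ht.le hv1
      obtain ⟨h0, h1⟩ := hq ⟨hz0, hz1⟩
      refine ⟨?_, ?_⟩
      · simp only [PiLp.sub_apply, hσp.1, sub_zero]; exact h0
      · simp only [PiLp.sub_apply, hσp.2, sub_zero]; exact h1
  obtain ⟨ha, hc⟩ := hcone e0 (by simp [he0]) (by simp [he0])
  obtain ⟨hb, hd⟩ := hcone e1 (by simp [he1]) (by simp [he1])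
  -- the entries
  set a := L e0 0 with ha'
  set c := L e0 1 with hc'
  set b := L e1 0 with hb'
  set d := L e1 1 with hd'
  refine ⟨⟨ha, hc, hb, hd⟩, ?_⟩
  -- the normal block is invertible: `a d - b c ≠ 0`
  have hdet : a * d - b * c ≠ 0 := by
    intro hdet
    -- a nonzero normal vector killed by the normal block
    have hkill : ∀ α β : ℝ, a * α + b * β = 0 → c * α + d * β = 0 → α = 0 ∧ β = 0 := by
      intro α β h1 h2
      set w : EuclideanSpace ℝ (Fin 4) := α • e0 + β • e1 with hw
      have hLw0 : L w 0 = 0 := by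
        simp only [hw, map_add, map_smul, PiLp.add_apply, PiLp.smul_apply, smul_eq_mul]
        rw [← ha', ← hb']; linarith
      have hLw1 : L w 1 = 0 := by
        simp only [hw, map_add, map_smul, PiLp.add_apply, PiLp.smul_apply, smul_eq_mul]
        rw [← hc', ← hd']; linarith
      obtain ⟨hw0, hw1⟩ := stratum_of_apply_stratum hLinj hLstr hLw0 hLw1
      simp [hw, he0, he1] at hw0 hw1
      exact ⟨hw0, hw1⟩
    -- try `(α, β) = (d, -c)`, then `(b, -a)`
    have h1 := hkill d (-c) (by linear_combination hdet) (by ring)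
    have h2 := hkill b (-a) (by ring) (by linear_combination -hdet)
    obtain ⟨hd0, hc0⟩ := h1
    obtain ⟨hb0, ha0⟩ := h2
    -- all entries vanish: then `e₀` is killed, contradiction
    have := hkill 1 0 (by rw [neg_eq_zero.mp ha0, hb0]; ring)
      (by rw [neg_eq_zero.mp hc0, hd0]; ring)
    exact one_ne_zero this.1
  -- nonnegative entries with `a d ≠ b c`: the permanent is positive
  rcases (mul_nonneg ha hd).lt_or_eq with h | h
  · nlinarith [mul_nonneg hb hc]
  · rcases (mul_nonneg hb hc).lt_or_eq with h' | h'
    · nlinarith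
    · exfalso; apply hdet; rw [← h, ← h']; ring

end Permanent


section BumpGeneral

/-- A `C^∞` function on a ball, cut off by a bump function supported inside the ball (any
centre), is `C^∞` on all of `ℝ⁴`. [folklore] -/
theorem contDiff_bump_mul' {c : EuclideanSpace ℝ (Fin 4)} {f : EuclideanSpace ℝ (Fin 4) → ℝ}
    {r : ℝ} (hf : ContDiffOn ℝ ∞ f (Metric.ball c r)) (χ : ContDiffBump c)
    (hχ : χ.rOut < r) : ContDiff ℝ ∞ fun q => χ q * f q := by
  rw [contDiff_iff_contDiffAt]
  intro q
  by_cases hq : q ∈ Metric.ball c r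
  · exact χ.contDiff.contDiffAt.mul (hf.contDiffAt (Metric.isOpen_ball.mem_nhds hq))
  · have hq' : q ∉ tsupport χ := by
      rw [χ.tsupport_eq]
      intro h
      exact hq (Metric.closedBall_subset_ball hχ h)
    have hev : (χ : EuclideanSpace ℝ (Fin 4) → ℝ) =ᶠ[𝓝 q] 0 :=
      notMem_tsupport_iff_eventuallyEq.mp hq'
    have hev' : (fun q => χ q * f q) =ᶠ[𝓝 q] fun _ => 0 := by
      filter_upwards [hev] with z hz
      rw [hz, Pi.zero_apply, zero_mul]
    exact (contDiffAt_const (c := (0:ℝ))).congr_of_eventuallyEq hev'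

end BumpGeneral

section CornerHadamardMain

universe u

variable {W : Type u} [TopologicalSpace W] [ChartedSpace (EuclideanHalfSpace 4) W]

/-- **A boundary-adapted smooth function read in a half-space chart: Hadamard form
`f ∘ φ⁻¹ = 1 - x₀ · c` near a boundary point, with `c > 0` at the point.**  Let `f : W → ℝ`
be a Morse function adapted to `∂W` (`= 1` and regular on `∂W`, `< 1` inside) and `φ` a chart of
the maximal atlas of `W` with `φ w₀ = 0`.  Then there are `r > 0` and a `C^∞` function `c` on
`ℝ⁴` with `c 0 > 0` such that `f w = 1 - (φ w)₀ · c (φ w)` whenever `φ w ∈ B(0, r)` (`w` in the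
chart domain): Seeley-extend `f ∘ φ⁻¹` across the boundary hyperplane, where it equals `1`
(boundary points, by invariance of the boundary for charts of the maximal atlas), and divide by
`x₀` (Hadamard); `c 0 = -∂₀(f ∘ φ⁻¹)(0)` is `≥ 0` because `f ≤ 1` and `≠ 0` because `w₀` is a
regular boundary point. [cite: Milnor1963, §2; Seeley1964, Theorem] -/
theorem exists_hadamard_of_isMorseAdapted {f : W → ℝ} (hf : IsMorseAdapted (𝓡∂ 4) f)
    {φ : OpenPartialHomeomorph W (EuclideanHalfSpace 4)}
    (hφ : φ ∈ IsManifold.maximalAtlas (𝓡∂ 4) ∞ W) {w₀ : W} (hw₀ : w₀ ∈ φ.source)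
    (hw₀0 : (φ w₀).val = 0) :
    ∃ (r : ℝ) (c : EuclideanSpace ℝ (Fin 4) → ℝ), 0 < r ∧ ContDiff ℝ ∞ c ∧ 0 < c 0 ∧
      (∀ z ∈ Metric.ball (0 : EuclideanSpace ℝ (Fin 4)) r, 0 < c z) ∧
      ∀ w ∈ φ.source, φ.extend (𝓡∂ 4) w ∈ Metric.ball (0 : EuclideanSpace ℝ (Fin 4)) r →
        f w = 1 - φ.extend (𝓡∂ 4) w 0 * c (φ.extend (𝓡∂ 4) w) := by
  have hφ0 : φ.extend (𝓡∂ 4) w₀ = 0 := extend_apply_eq_zero hw₀0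
  set V' : Set (EuclideanSpace ℝ (Fin 4)) := (𝓡∂ 4).symm ⁻¹' φ.target with hV'
  have hV'o : IsOpen V' := φ.open_target.preimage (𝓡∂ 4).continuous_symm
  have htgt : (φ.extend (𝓡∂ 4)).target = V' ∩ {z | 0 ≤ z 0} := extend_target_eq_inter_halfSpace φ
  have h0tgt : (0 : EuclideanSpace ℝ (Fin 4)) ∈ (φ.extend (𝓡∂ 4)).target := by
    rw [← hφ0]; exact (φ.extend (𝓡∂ 4)).map_source (by rwa [OpenPartialHomeomorph.extend_source])
  have h0V' : (0 : EuclideanSpace ℝ (Fin 4)) ∈ V' := by rw [htgt] at h0tgt; exact h0tgt.1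
  -- `f` read in the chart is smooth on the half-space piece; Seeley
  set gf : EuclideanSpace ℝ (Fin 4) → ℝ := f ∘ (φ.extend (𝓡∂ 4)).symm with hgf
  have hgfs : ContDiffOn ℝ ∞ gf (V' ∩ {z | 0 ≤ z 0}) := by
    rw [← htgt]
    have h1 : ContMDiffOn 𝓘(ℝ, EuclideanSpace ℝ (Fin 4)) (𝓡∂ 4) ∞ (φ.extend (𝓡∂ 4)).symm
        (φ.extend (𝓡∂ 4)).target := by
      rw [OpenPartialHomeomorph.extend_target']
      exact contMDiffOn_extend_symm hφ
    exact contMDiffOn_iff_contDiffOn.mp (hf.isMorse.contMDiff.comp_contMDiffOn h1)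
  obtain ⟨V₁, hV₁o, h0V₁, hV₁V', G, hGs, hGg⟩ :=
    exists_contDiffOn_extension_halfSpace hV'o h0V' hgfs
  -- `G = 1` on the boundary hyperplane
  have hG1 : ∀ z ∈ V₁, z 0 = 0 → G z = 1 := by
    intro z hz hz0
    have hzt : z ∈ (φ.extend (𝓡∂ 4)).target := by
      rw [htgt]; exact ⟨hV₁V' hz, le_of_eq hz0.symm⟩
    set w := (φ.extend (𝓡∂ 4)).symm z with hw
    have hwsrc : w ∈ φ.source := by
      have := (φ.extend (𝓡∂ 4)).map_target hzt
      rwa [OpenPartialHomeomorph.extend_source] at this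
    have hzw : φ.extend (𝓡∂ 4) w = z := (φ.extend (𝓡∂ 4)).right_inv hzt
    -- `w` is a boundary point
    have hbd : (𝓡∂ 4).IsBoundaryPoint w := by
      rw [ModelWithCorners.isBoundaryPoint_iff_not_isInteriorPoint]
      intro hint
      have h := mem_interior_range_of_mem_maximalAtlas hφ hwsrc hint
      rw [hzw, range_modelWithCornersEuclideanHalfSpace, interior_halfSpace] at h
      exact absurd hz0 (ne_of_gt h)
    have hf1 : f w = 1 := (hf.2.1 w hbd).1
    rw [hGg ⟨hz, le_of_eq hz0.symm⟩, hgf, comp_apply, ← hw, hf1]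
  -- a ball inside `V₁`, a bump function, and the globalised `H = bump · (1 - G)`
  obtain ⟨r₁, hr₁, hball⟩ := Metric.isOpen_iff.1 hV₁o 0 h0V₁
  set β : ContDiffBump (0 : EuclideanSpace ℝ (Fin 4)) := ⟨r₁ / 4, r₁ / 2, by linarith, by linarith⟩
    with hβ
  set H : EuclideanSpace ℝ (Fin 4) → ℝ := fun z => β z * (1 - G z) with hH
  have hHs : ContDiff ℝ ∞ H :=
    contDiff_bump_mul' ((contDiffOn_const.sub hGs).mono hball) β (by show r₁ / 2 < r₁; linarith)
  have hHeq : ∀ z ∈ Metric.ball (0 : EuclideanSpace ℝ (Fin 4)) (r₁ / 4), H z = 1 - G z := by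
    intro z hz
    have : β z = 1 := β.one_of_mem_closedBall (Metric.ball_subset_closedBall hz)
    simp only [hH, this, one_mul]
  have hH0 : ∀ z ∈ Metric.ball (0 : EuclideanSpace ℝ (Fin 4)) r₁, z 0 = 0 → True → H z = 0 := by
    intro z hz hz0 _
    simp only [hH, hG1 z (hball hz) hz0, sub_self, mul_zero]
  -- Hadamard along the hyperplane `{z₀ = 0}`
  set c : EuclideanSpace ℝ (Fin 4) → ℝ := fun z => ∫ s in (0:ℝ)..1,
    fderiv ℝ H (z + (s * z 0 - z 0) • EuclideanSpace.single 0 (1:ℝ)) (EuclideanSpace.single 0 1)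
    with hc
  have hcs : ContDiff ℝ ∞ c := by
    have : ContDiff ℝ ((⊤ : ℕ∞) + 1) H := by exact_mod_cast hHs
    have := contDiff_face_integral (0 : Fin 4) (n := ⊤) this
    exact_mod_cast this
  have hHc : ∀ z ∈ Metric.ball (0 : EuclideanSpace ℝ (Fin 4)) r₁, H z = z 0 * c z := fun z hz =>
    eq_mul_integral_of_face 0 (side := fun _ => True) (fun _ _ _ => trivial)
      (hHs.of_le (by norm_cast)) rfl hH0 hz trivial
  -- `f = 1 - x₀ · c(x)` in the chart, near `w₀`
  have hr₁4 : Metric.ball (0 : EuclideanSpace ℝ (Fin 4)) (r₁ / 4) ⊆ Metric.ball 0 r₁ :=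
    Metric.ball_subset_ball (by linarith)
  have hfw : ∀ w ∈ φ.source,
      φ.extend (𝓡∂ 4) w ∈ Metric.ball (0 : EuclideanSpace ℝ (Fin 4)) (r₁ / 4) →
      f w = 1 - φ.extend (𝓡∂ 4) w 0 * c (φ.extend (𝓡∂ 4) w) := by
    intro w hw hwball
    set z := φ.extend (𝓡∂ 4) w with hz
    have hzV₁ : z ∈ V₁ := hball (hr₁4 hwball)
    have hz0 : 0 ≤ z 0 := extend_apply_zero_nonneg φ w
    have hGz : G z = f w := by
      rw [hGg ⟨hzV₁, hz0⟩, hgf, comp_apply, hz,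
        (φ.extend (𝓡∂ 4)).left_inv (by rwa [OpenPartialHomeomorph.extend_source])]
    have := hHc z (hr₁4 hwball)
    rw [hHeq z hwball, hGz] at this
    linarith
  -- `w₀` is a boundary point, hence regular for `f`
  have hbd₀ : (𝓡∂ 4).IsBoundaryPoint w₀ := by
    rw [ModelWithCorners.isBoundaryPoint_iff_not_isInteriorPoint]
    intro hint
    have h := mem_interior_range_of_mem_maximalAtlas hφ hw₀ hint
    rw [hφ0, range_modelWithCornersEuclideanHalfSpace, interior_halfSpace] at h
    exact absurd (show (0:ℝ) < (0 : EuclideanSpace ℝ (Fin 4)) 0 from h) (by simp)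
  have hreg₀ : ¬ IsMCriticalPt (𝓡∂ 4) f w₀ := (hf.2.1 w₀ hbd₀).2
  -- the derivative of `H` at `0` is `c 0 • proj₀`
  have hHd : HasFDerivAt H (c 0 • EuclideanSpace.proj (𝕜 := ℝ) (0 : Fin 4)) 0 := by
    have h1 : HasFDerivAt (fun z : EuclideanSpace ℝ (Fin 4) => z 0 * c z)
        ((0 : EuclideanSpace ℝ (Fin 4)) 0 • fderiv ℝ c 0 +
          c 0 • EuclideanSpace.proj (𝕜 := ℝ) (0 : Fin 4)) 0 :=
      ((EuclideanSpace.proj (𝕜 := ℝ) (0 : Fin 4)).hasFDerivAt).mul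
        ((hcs.differentiable (by simp)) 0).hasFDerivAt
    simp only [PiLp.zero_apply, zero_smul, zero_add] at h1
    refine h1.congr_of_eventuallyEq ?_
    filter_upwards [Metric.isOpen_ball.mem_nhds (Metric.mem_ball_self hr₁)] with z hz
    exact hHc z hz
  -- `c 0 ≠ 0`: otherwise `w₀` would be critical
  have hc0ne : c 0 ≠ 0 := by
    intro hc0
    apply hreg₀
    -- `f = (1 - H) ∘ φ.extend` near `w₀`
    have hev : f =ᶠ[𝓝 w₀] ((fun z : EuclideanSpace ℝ (Fin 4) => 1 - H z) ∘ φ.extend (𝓡∂ 4)) := by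
      have hcont : ContinuousAt (φ.extend (𝓡∂ 4)) w₀ := φ.continuousAt_extend hw₀
      have h1 : ∀ᶠ w in 𝓝 w₀,
          φ.extend (𝓡∂ 4) w ∈ Metric.ball (0 : EuclideanSpace ℝ (Fin 4)) (r₁ / 4) := by
        apply hcont.preimage_mem_nhds
        rw [hφ0]; exact Metric.isOpen_ball.mem_nhds (Metric.mem_ball_self (by linarith))
      filter_upwards [h1, φ.open_source.mem_nhds hw₀] with w hw1 hw2
      rw [hfw w hw2 hw1]
      show _ = 1 - H (φ.extend (𝓡∂ 4) w)
      rw [hHc _ (hr₁4 hw1)]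
    have hdext : MDifferentiableAt (𝓡∂ 4) 𝓘(ℝ, EuclideanSpace ℝ (Fin 4)) (φ.extend (𝓡∂ 4)) w₀ :=
      (φ.contMDiffAt_extend hφ hw₀).mdifferentiableAt (by simp)
    have houter : HasFDerivAt (fun z : EuclideanSpace ℝ (Fin 4) => 1 - H z)
        (0 : EuclideanSpace ℝ (Fin 4) →L[ℝ] ℝ) 0 := by
      have := (hasFDerivAt_const (1:ℝ) (0 : EuclideanSpace ℝ (Fin 4))).sub hHd
      rw [hc0, zero_smul, sub_zero] at this
      exact this
    have houter' : HasMFDerivAt 𝓘(ℝ, EuclideanSpace ℝ (Fin 4)) 𝓘(ℝ, ℝ)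
        (fun z : EuclideanSpace ℝ (Fin 4) => 1 - H z) (φ.extend (𝓡∂ 4) w₀)
        (0 : EuclideanSpace ℝ (Fin 4) →L[ℝ] ℝ) := by
      rw [hφ0]; exact houter.hasMFDerivAt
    have hcomp := houter'.comp w₀ hdext.hasMFDerivAt
    unfold IsMCriticalPt
    rw [Filter.EventuallyEq.mfderiv_eq hev]
    exact hcomp.mfderiv.trans (ContinuousLinearMap.zero_comp _)
  -- `c 0 ≥ 0`: `f ≤ 1`
  have hfle : ∀ w, f w ≤ 1 := by
    intro w
    rcases (𝓡∂ 4).isInteriorPoint_or_isBoundaryPoint w with hw | hw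
    · exact (hf.2.2 w hw).le
    · exact le_of_eq (hf.2.1 w hw).1
  have hc0nn : 0 ≤ c 0 := by
    -- along `t e₀`, `t → 0⁺`: `c (t e₀) ≥ 0`
    have hev : ∀ᶠ t in 𝓝[>] (0:ℝ), 0 ≤ c (t • EuclideanSpace.single 0 (1:ℝ)) := by
      have hc' : Continuous fun t : ℝ => t • EuclideanSpace.single (0 : Fin 4) (1:ℝ) := by fun_prop
      have hlim : Tendsto (fun t : ℝ => t • EuclideanSpace.single (0 : Fin 4) (1:ℝ)) (𝓝 0)
          (𝓝 0) := by
        simpa using hc'.tendsto 0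
      have hV : ∀ᶠ t in 𝓝 (0:ℝ), t • EuclideanSpace.single (0 : Fin 4) (1:ℝ) ∈
          V' ∩ Metric.ball (0 : EuclideanSpace ℝ (Fin 4)) (r₁ / 4) :=
        hlim ((hV'o.inter Metric.isOpen_ball).mem_nhds ⟨h0V', Metric.mem_ball_self (by linarith)⟩)
      filter_upwards [hV.filter_mono nhdsWithin_le_nhds, self_mem_nhdsWithin] with t ht htpos
      have htpos' : 0 < t := htpos
      set z : EuclideanSpace ℝ (Fin 4) := t • EuclideanSpace.single 0 (1:ℝ) with hz
      have hz0 : z 0 = t := by simp [hz]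
      have hzt : z ∈ (φ.extend (𝓡∂ 4)).target := by
        rw [htgt]; exact ⟨ht.1, by show 0 ≤ z 0; rw [hz0]; exact htpos'.le⟩
      set w := (φ.extend (𝓡∂ 4)).symm z with hw
      have hwsrc : w ∈ φ.source := by
        have := (φ.extend (𝓡∂ 4)).map_target hzt
        rwa [OpenPartialHomeomorph.extend_source] at this
      have hzw : φ.extend (𝓡∂ 4) w = z := (φ.extend (𝓡∂ 4)).right_inv hzt
      have h := hfw w hwsrc (by rw [hzw]; exact ht.2)
      rw [hzw, hz0] at h
      have : t * c z ≥ 0 := by linarith [hfle w]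
      exact nonneg_of_mul_nonneg_right (by linarith) htpos'
    have hlim : Tendsto (fun t : ℝ => c (t • EuclideanSpace.single (0 : Fin 4) (1:ℝ))) (𝓝[>] 0)
        (𝓝 (c 0)) := by
      have hc' : Continuous fun t : ℝ => c (t • EuclideanSpace.single (0 : Fin 4) (1:ℝ)) :=
        hcs.continuous.comp (by fun_prop)
      simpa using (hc'.tendsto 0).mono_left nhdsWithin_le_nhds
    exact ge_of_tendsto hlim hev
  have hc0 : 0 < c 0 := lt_of_le_of_ne hc0nn (Ne.symm hc0ne)
  -- `c > 0` on a ball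
  obtain ⟨r₂, hr₂, hball₂⟩ :
      ∃ r₂ > 0, Metric.ball (0 : EuclideanSpace ℝ (Fin 4)) r₂ ⊆ {z | 0 < c z} :=
    Metric.isOpen_iff.1 (isOpen_lt continuous_const hcs.continuous) 0 hc0
  refine ⟨min (r₁ / 4) r₂, c, lt_min (by linarith) hr₂, hcs, hc0, fun z hz => hball₂ ?_,
    fun w hw hwz => ?_⟩
  · exact Metric.ball_subset_ball (min_le_right _ _) hz
  · exact hfw w hw (Metric.ball_subset_ball (min_le_left _ _) hwz)

end CornerHadamardMain


end Literature.Topology.FourManifolds
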